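import Summits.CriticalPhenomena.CardyFormulaZ2.Theorems.CardyUSTContinuationKirchhoffExtremalLengthG02CrossWalks
import Summits.CriticalPhenomena.CardyFormulaZ2.Theorems.CardyUSTContinuationKirchhoffExtremalLengthG02CrossWind
import Summits.CriticalPhenomena.CardyFormulaZ2.Theorems.CardyUSTContinuationKirchhoffExtremalLengthG02CrossSep
import Summits.CriticalPhenomena.CardyFormulaZ2.Theorems.CardyUSTContinuationKirchhoffExtremalLengthG02Dual6

/-!
# The flux between the exits at the ends of the crosscut is `±` the current out of `A_δ`
# ([GP19] §3 for the `meshDomain` / `discreteArc` discretisation)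

Support file for `KirchhoffExtremalLength` (route CardyUSTContinuation of `CardyFormulaZ2`, item
stmt-CriticalPhenomena-11234), towards the upper half of `G02ModulusConvergence` (`…Defs.lean`).
Transposition of the tree's `SquareTiling.exists_exits_flux_eq` (the lattice part of the
identification `h'(r) - h'(l) = I*` of [GP19] §3, on `ℤ²` without planar duality) to
`Ω_δ = discreteDomainGraph Ω δ`. The one change of substance: the loop through the two exits is
closed not through the boundary arcs near `q_t`, `q_b` (whose shadows may carry flux for `Ω_δ`,
the mesh edges being closed segments in `Ω̄`) but by the shadow of an exterior path through the
closing curves (`exists_fluxFree_walk`, `exterior_joinedIn_of_closing_curves`); the column, the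
exits and the walks to them are `exists_crosscut_walks`, the crossing with `Γ_H` is
`walkWinding_sub_eq_one_of_crossData`, and the flux bookkeeping is
`faceExitVal_sub_eq_of_crossData`.
-/

noncomputable section

namespace Summit.CriticalPhenomena.CardyFormulaZ2.Theorems

namespace KirchhoffSlope

open Set Metric Filter Topology SimpleGraph
open Literature.Probability Literature.Probability.LatticeModels Literature.Probability.Percolation
open Literature.Probability.LatticeModels.SquareTiling (walkFlux closedSq floorSq upRun dist_le_of_mem_closedSq
  not_near_both divAt)
open Literature.Probability.RandomPlanarGeometry

variable {δ : ℝ}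

set_option maxHeartbeats 1600000 in
open Classical in
/-- **The flux between the exits at the ends of the crosscut is `±` the current out of `A_δ`**
(for `Ω_δ = discreteDomainGraph Ω δ`; cf. `SquareTiling.exists_exits_flux_eq`). Given the cross
data of the conformal rectangle (two curves `Γ_V`, `Γ_H` in `Ω` from the open arcs `1 → 3` and
`j_L → j_R`, straightened near their crossing point) and exterior closing curves at
`q_t = Γ_V 1`, `q_b = Γ_V 0`, for every small mesh and every potential `h` harmonic off the
disjoint discrete arcs `A_δ`, `B_δ`, the conjugate based at the face of the crossing point has
exits `(p_b, n_b)`, `(p_t, n_t)` whose outer squares contain points within `η` of `q_b`, `q_t`,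
and `E(p_t, n_t) - E(p_b, n_b) = σ Σ_{x ∈ A_δ} div(x)` with `σ = 1` if `j_L = 0`, `σ = -1` if
`j_L = 2`. [cite: GeorgakopoulosPanagiotis2019, §3 (duality, on `ℤ²`)] -/
theorem exists_exits_flux_eq' (R : ConformalRectangle)
    {ΓV ΓH : ℝ → ℂ} {c₀ : ℂ} {r xs ys tᵢ tₒ sᵢ sₒ : ℝ} {jL jR : Fin 4}
    (hVc : ContinuousOn ΓV (Icc 0 1)) (hHc : ContinuousOn ΓH (Icc 0 1))
    (hV0 : ∃ σ ∈ Ioo (R.mark 1) (R.nextMark 1), ΓV 0 = R.boundary σ)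
    (hV1 : ∃ σ ∈ Ioo (R.mark 3) (R.nextMark 3), ΓV 1 = R.boundary σ)
    (hH0 : ∃ σ ∈ Ioo (R.mark jL) (R.nextMark jL), ΓH 0 = R.boundary σ)
    (hH1 : ∃ σ ∈ Ioo (R.mark jR) (R.nextMark jR), ΓH 1 = R.boundary σ)
    (hLR : (jL = 0 ∧ jR = 2) ∨ (jL = 2 ∧ jR = 0))
    (hVΩ : ∀ t ∈ Ioo (0 : ℝ) 1, ΓV t ∈ R.carrier) (hHΩ : ∀ s ∈ Ioo (0 : ℝ) 1, ΓH s ∈ R.carrier)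
    (hr : 0 < r) (hballΩ : closedBall c₀ r ⊆ R.carrier)
    (htᵢ : 0 < tᵢ) (htᵢₒ : tᵢ < tₒ) (htₒ : tₒ < 1) (hsᵢ : 0 < sᵢ) (hsᵢₒ : sᵢ < sₒ) (hsₒ : sₒ < 1)
    (hxs : |xs - c₀.re| < r / 5) (hys : |ys - c₀.im| < r / 5)
    (hdisjA : Disjoint (ΓV '' Icc 0 tᵢ ∪ segment ℝ (ΓV tᵢ) ⟨xs, c₀.im - r / 2⟩ ∪ segment ℝ ⟨xs, c₀.im + r / 2⟩ (ΓV tₒ) ∪ ΓV '' Icc tₒ 1)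
      (ΓH '' Icc 0 sᵢ ∪ segment ℝ (ΓH sᵢ) ⟨c₀.re - r / 2, ys⟩ ∪ segment ℝ ⟨c₀.re - r / 2, ys⟩ ⟨c₀.re + r / 2, ys⟩ ∪
        segment ℝ ⟨c₀.re + r / 2, ys⟩ (ΓH sₒ) ∪ ΓH '' Icc sₒ 1))
    (hdisjB : Disjoint (ΓH '' Icc 0 sᵢ ∪ segment ℝ (ΓH sᵢ) ⟨c₀.re - r / 2, ys⟩ ∪ segment ℝ ⟨c₀.re + r / 2, ys⟩ (ΓH sₒ) ∪ ΓH '' Icc sₒ 1)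
      (ΓV '' Icc 0 tᵢ ∪ segment ℝ (ΓV tᵢ) ⟨xs, c₀.im - r / 2⟩ ∪ segment ℝ ⟨xs, c₀.im - r / 2⟩ ⟨xs, c₀.im + r / 2⟩ ∪
        segment ℝ ⟨xs, c₀.im + r / 2⟩ (ΓV tₒ) ∪ ΓV '' Icc tₒ 1))
    (hA234 : segment ℝ (ΓV tᵢ) ⟨xs, c₀.im - r / 2⟩ ∪ segment ℝ ⟨xs, c₀.im - r / 2⟩ ⟨xs, c₀.im + r / 2⟩ ∪
      segment ℝ ⟨xs, c₀.im + r / 2⟩ (ΓV tₒ) ⊆ closedBall c₀ r)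
    (hB234 : segment ℝ (ΓH sᵢ) ⟨c₀.re - r / 2, ys⟩ ∪ segment ℝ ⟨c₀.re - r / 2, ys⟩ ⟨c₀.re + r / 2, ys⟩ ∪
      segment ℝ ⟨c₀.re + r / 2, ys⟩ (ΓH sₒ) ⊆ closedBall c₀ r)
    (hVarc : ∀ t ∈ Icc (0 : ℝ) 1, ΓV t ∉ R.arc 0 ∧ ΓV t ∉ R.arc 2)
    {Et Eb M : ℝ → ℂ} (hEtc : ContinuousOn Et (Icc 1 2)) (hEbc : ContinuousOn Eb (Icc 1 2)) (hMc : ContinuousOn M (Icc 0 1))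
    (hEt1 : Et 1 = ΓV 1) (hEb1 : Eb 1 = ΓV 0) (hEt : ∀ t ∈ Ioc (1 : ℝ) 2, Et t ∈ (closure R.carrier)ᶜ)
    (hEb : ∀ t ∈ Ioc (1 : ℝ) 2, Eb t ∈ (closure R.carrier)ᶜ) (hM : ∀ s ∈ Icc (0 : ℝ) 1, M s ∈ (closure R.carrier)ᶜ)
    (hM0 : M 0 = Et 2) (hM1 : M 1 = Eb 2) {η : ℝ} (hη : 0 < η) :
    ∃ δ₀ > 0, ∀ δ, 0 < δ → δ < δ₀ → ∀ h : Site 2 → ℝ, ∀ hfin : (discreteArc R.carrier δ (R.arc 0)).Finite,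
      Disjoint (discreteArc R.carrier δ (R.arc 0)) (discreteArc R.carrier δ (R.arc 2)) →
      (∀ x, x ∉ discreteArc R.carrier δ (R.arc 0) → x ∉ discreteArc R.carrier δ (R.arc 2) →
        ∑ y ∈ ((zdGraph 2).neighborFinset x).filter (fun y => (discreteDomainGraph R.carrier δ).Adj x y), (h y - h x) = 0) →
      IsInnerFace R.carrier δ ![⌊xs / δ⌋, ⌊ys / δ⌋] ∧
      ∃ pb nb pt nt : Site 2, (zdGraph 2).Adj pb nb ∧ (zdGraph 2).Adj pt nt ∧
        (faceGraph R.carrier δ).Reachable ![⌊xs / δ⌋, ⌊ys / δ⌋] pb ∧ (faceGraph R.carrier δ).Reachable ![⌊xs / δ⌋, ⌊ys / δ⌋] pt ∧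
        ¬ (faceGraph R.carrier δ).Reachable ![⌊xs / δ⌋, ⌊ys / δ⌋] nb ∧ ¬ (faceGraph R.carrier δ).Reachable ![⌊xs / δ⌋, ⌊ys / δ⌋] nt ∧
        (∃ w ∈ closedSq δ nb, dist w (ΓV 0) < η) ∧ (∃ w ∈ closedSq δ nt, dist w (ΓV 1) < η) ∧
        faceExitVal R.carrier δ h ![⌊xs / δ⌋, ⌊ys / δ⌋] pt nt - faceExitVal R.carrier δ h ![⌊xs / δ⌋, ⌊ys / δ⌋] pb nb =
          (if jL = 0 then (1 : ℝ) else -1) *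
            ∑ x ∈ hfin.toFinset, divAt (ecurH R.carrier δ h) (ecurV R.carrier δ h) (x - 1) := by
  -- ### notation
  set qb := ΓV 0 with hqbdef
  set qt := ΓV 1 with hqtdef
  set Qvm : ℂ := ⟨xs, c₀.im - r / 2⟩ with hQvm
  set Qvp : ℂ := ⟨xs, c₀.im + r / 2⟩ with hQvp
  set Qhm : ℂ := ⟨c₀.re - r / 2, ys⟩ with hQhm
  set Qhp : ℂ := ⟨c₀.re + r / 2, ys⟩ with hQhp
  set A1 : Set ℂ := ΓV '' Icc 0 tᵢ with hA1
  set A2 : Set ℂ := segment ℝ (ΓV tᵢ) Qvm with hA2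
  set A3 : Set ℂ := segment ℝ Qvm Qvp with hA3
  set A4 : Set ℂ := segment ℝ Qvp (ΓV tₒ) with hA4
  set A5 : Set ℂ := ΓV '' Icc tₒ 1 with hA5
  set B1 : Set ℂ := ΓH '' Icc 0 sᵢ with hB1
  set B2 : Set ℂ := segment ℝ (ΓH sᵢ) Qhm with hB2
  set B3 : Set ℂ := segment ℝ Qhm Qhp with hB3
  set B4 : Set ℂ := segment ℝ Qhp (ΓH sₒ) with hB4
  set B5 : Set ℂ := ΓH '' Icc sₒ 1 with hB5
  set Aout : Set ℂ := A1 ∪ A2 ∪ A4 ∪ A5 with hAout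
  set Aall : Set ℂ := A1 ∪ A2 ∪ A3 ∪ A4 ∪ A5 with hAall
  set Bout : Set ℂ := B1 ∪ B2 ∪ B4 ∪ B5 with hBout
  set Ball : Set ℂ := B1 ∪ B2 ∪ B3 ∪ B4 ∪ B5 with hBall
  set Ext : Set ℂ := Et '' Icc 1 2 ∪ M '' Icc 0 1 ∪ Eb '' Icc 1 2 with hExt
  have hA3sub : A3 ⊆ Aall := fun z hz => Or.inl (Or.inl (Or.inr hz))
  have hAoutsub : Aout ⊆ Aall := by
    rintro z (((h | h) | h) | h)
    · exact Or.inl (Or.inl (Or.inl (Or.inl h)))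
    · exact Or.inl (Or.inl (Or.inl (Or.inr h)))
    · exact Or.inl (Or.inr h)
    · exact Or.inr h
  have hB3sub : B3 ⊆ Ball := fun z hz => Or.inl (Or.inl (Or.inr hz))
  have hBoutsub : Bout ⊆ Ball := by
    rintro z (((h | h) | h) | h)
    · exact Or.inl (Or.inl (Or.inl (Or.inl h)))
    · exact Or.inl (Or.inl (Or.inl (Or.inr h)))
    · exact Or.inl (Or.inr h)
    · exact Or.inr h
  -- ### the constants
  obtain ⟨η₀, hη₀, hsep₁, hsep₂, hsep₃, hd₁, hd₂, hsep₅, hsep₆⟩ := exists_cross_constant R hVc hHc hV0 hV1 hH0 hH1 hLR hVΩ hHΩ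
    hballΩ htᵢ htᵢₒ htₒ hsᵢ hsᵢₒ hsₒ hdisjA hdisjB hA234 hB234 hVarc hEtc hEbc hMc hEt1 hEb1 hEt hEb hM
  set r' : ℝ := min (η₀ / 2) (η / 2) with hr'
  have hr'0 : 0 < r' := by positivity
  have hr'η₀ : r' ≤ η₀ / 2 := min_le_left _ _
  have hr'η : r' ≤ η / 2 := min_le_right _ _
  obtain ⟨θm, hθm, hmid⟩ := exterior_joinedIn_of_closing_curves R hEtc hEbc hMc hEt hEb hM hM0 hM1 hr'0
  set r'' : ℝ := min (θm / 2) (r' / 2) with hr''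
  have hr''0 : 0 < r'' := by positivity
  have hr''θ : r'' ≤ θm / 2 := min_le_left _ _
  have hr''r' : r'' ≤ r' / 2 := min_le_right _ _
  obtain ⟨δ₁, hδ₁, hwalks⟩ := exists_crosscut_walks R hVc htᵢ htᵢₒ htₒ hVΩ hr hballΩ hxs hys hA234 hEtc hEbc hEt1 hEb1 hEt hEb hr''0
  obtain ⟨σH0, hσH0, hH0eq⟩ := hH0
  obtain ⟨σH1, hσH1, hH1eq⟩ := hH1
  refine ⟨min δ₁ (min (r'' / 8) (η₀ / 16)), by positivity, fun δ hδ hδlt h hfin hTBn hharm => ?_⟩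
  have hδ₁' : δ < δ₁ := hδlt.trans_le (min_le_left _ _)
  have hδr'' : 8 * δ < r'' := by have := hδlt.trans_le ((min_le_right _ _).trans (min_le_left _ _)); linarith
  have hδη₀ : 16 * δ < η₀ := by have := hδlt.trans_le ((min_le_right _ _).trans (min_le_right _ _)); linarith
  obtain ⟨Cm, K, hcol, hcol', hrow, hrow', hcol_inner, hp₀col, hcoltouch, pb, nb, pt, nt, hpbnb, hptnt, w₁, u₁,
    hw₁F, hu₁F, hnbF, hntF, hw₁touch, hu₁touch, hnb_near, hnt_near⟩ := hwalks δ hδ hδ₁'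
  set p₀ : Site 2 := ![⌊xs / δ⌋, ⌊ys / δ⌋] with hp₀def
  have hp₀inner : IsInnerFace R.carrier δ p₀ := hcol_inner p₀ hp₀col
  have hreach_inner : ∀ {q : Site 2}, (faceGraph R.carrier δ).Reachable p₀ q → IsInnerFace R.carrier δ q := fun hq => by
    obtain ⟨W⟩ := hq; exact isInnerFace_of_mem_support' hp₀inner W (Walk.end_mem_support _)
  have hexit_notinner : ∀ {p n : Site 2}, (faceGraph R.carrier δ).Reachable p₀ p → (zdGraph 2).Adj p n →
      ¬ (faceGraph R.carrier δ).Reachable p₀ n → ¬ IsInnerFace R.carrier δ n := fun hp hpn hn hnI =>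
    hn (hp.trans (faceGraph_adj_iff.2 ⟨hpn, hreach_inner hp, hnI⟩).reachable)
  have hptF : (faceGraph R.carrier δ).Reachable p₀ pt := hu₁F _ (Walk.end_mem_support _)
  have hpbF : (faceGraph R.carrier δ).Reachable p₀ pb := hw₁F _ (Walk.end_mem_support _)
  have hnt_ni : ¬ IsInnerFace R.carrier δ nt := hexit_notinner hptF hptnt hntF
  have hnb_ni : ¬ IsInnerFace R.carrier δ nb := hexit_notinner hpbF hpbnb hnbF
  -- ### the flux-free closing walk through the exterior
  have h3δθ : r'' + 3 * δ ≤ θm := by linarith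
  have h3δr' : r'' + 3 * δ ≤ r' := by linarith
  obtain ⟨β, hβ0, hβs⟩ := exists_fluxFree_walk R hδ h (qa := qt) (qb := qb) (r := r'')
    (S := Et '' Icc 1 2 ∪ M '' Icc 0 1 ∪ Eb '' Icc 1 2 ∪ ball (Et 1) r' ∪ ball (Eb 1) r')
    (fun e₁ e₂ he₁ he₂ h₁ h₂ => hmid e₁ e₂ he₁ he₂ (by rw [hEt1]; linarith) (by rw [hEb1]; linarith))
    (hreach_inner hptF) hptnt hnt_ni (hreach_inner hpbF) hpbnb hnb_ni hnt_near hnb_near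
  have hβs' : ∀ Q ∈ β.support, (∃ x ∈ Ext, x ∈ closedSq δ Q) ∨ ∃ x ∈ closedSq δ Q, dist x qt < r' ∨ dist x qb < r' := by
    intro Q hQ
    obtain ⟨w, hw, hw'⟩ := hβs Q hQ
    rcases hw' with ((hS | hS) | hS) | hd | hd
    · exact Or.inl ⟨w, hS, hw⟩
    · right; refine ⟨w, hw, Or.inl ?_⟩; rw [hEt1] at hS; exact Metric.mem_ball.1 hS
    · right; refine ⟨w, hw, Or.inr ?_⟩; rw [hEb1] at hS; exact Metric.mem_ball.1 hS
    · exact Or.inr ⟨w, hw, Or.inl (by linarith)⟩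
    · exact Or.inr ⟨w, hw, Or.inr (by linarith)⟩
  -- ### the loop
  set Λ₁ : (zdGraph 2).Walk nb Cm := Walk.cons hpbnb.symm w₁.reverse with hΛ₁
  set Λ₂ : (zdGraph 2).Walk (Cm + (K : ℤ) • (Pi.single 1 1 : Site 2)) nb := u₁.append (Walk.cons hptnt β) with hΛ₂
  set Λ : (zdGraph 2).Walk nb nb := (Λ₁.append (upRun Cm K)).append Λ₂ with hΛ
  set v : (zdGraph 2).Walk pb pt := w₁.reverse.append ((upRun Cm K).append u₁) with hv
  have hΛeq : (Walk.cons hpbnb.symm v).append (Walk.cons hptnt β) = Λ := by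
    simp only [hΛ, hΛ₁, hΛ₂, hv, Walk.cons_append, Walk.append_assoc]
  -- what the squares of the pieces touch
  have hΛ₁touch : ∀ q ∈ Λ₁.support, (∃ x ∈ Aout, x ∈ closedSq δ q) ∨ ∃ x ∈ closedSq δ q, dist x qt < r' ∨ dist x qb < r' := by
    intro q hq
    rw [hΛ₁, Walk.support_cons, List.mem_cons, Walk.support_reverse, List.mem_reverse] at hq
    rcases hq with rfl | hq
    · obtain ⟨x, hx, hxd⟩ := hnb_near; exact Or.inr ⟨x, hx, Or.inr (by linarith)⟩
    · rcases hw₁touch q hq with h' | ⟨x, hx, hxd⟩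
      · exact Or.inl h'
      · exact Or.inr ⟨x, hx, Or.inr (by linarith)⟩
  have hΛ₂touch : ∀ q ∈ Λ₂.support, (∃ x ∈ Aout, x ∈ closedSq δ q) ∨
      (∃ x ∈ closedSq δ q, dist x qt < r' ∨ dist x qb < r') ∨ (∃ x ∈ Ext, x ∈ closedSq δ q) := by
    intro q hq
    rw [hΛ₂, Walk.mem_support_append_iff, Walk.support_cons, List.mem_cons] at hq
    have hu : ∀ q ∈ u₁.support, (∃ x ∈ Aout, x ∈ closedSq δ q) ∨
        (∃ x ∈ closedSq δ q, dist x qt < r' ∨ dist x qb < r') ∨ (∃ x ∈ Ext, x ∈ closedSq δ q) := fun q hq => by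
      rcases hu₁touch q hq with h' | ⟨x, hx, hxd⟩
      · exact Or.inl h'
      · exact Or.inr (Or.inl ⟨x, hx, Or.inl (by linarith)⟩)
    rcases hq with hq | rfl | hq
    · exact hu q hq
    · exact hu _ (Walk.end_mem_support _)
    · rcases hβs' q hq with h' | h'
      · exact Or.inr (Or.inr h')
      · exact Or.inr (Or.inl h')
  have hΛtouch : ∀ q ∈ Λ.support, (∃ x ∈ Aall, x ∈ closedSq δ q) ∨
      (∃ x ∈ closedSq δ q, dist x qt < r' ∨ dist x qb < r') ∨ (∃ x ∈ Ext, x ∈ closedSq δ q) := by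
    intro q hq
    rw [hΛ, Walk.mem_support_append_iff, Walk.mem_support_append_iff] at hq
    rcases hq with (hq | hq) | hq
    · rcases hΛ₁touch q hq with ⟨x, hx, hxq⟩ | h'
      · exact Or.inl ⟨x, hAoutsub hx, hxq⟩
      · exact Or.inr (Or.inl h')
    · obtain ⟨x, hx, hxq⟩ := hcoltouch q hq; exact Or.inl ⟨x, hA3sub hx, hxq⟩
    · rcases hΛ₂touch q hq with ⟨x, hx, hxq⟩ | h' | h'
      · exact Or.inl ⟨x, hAoutsub hx, hxq⟩
      · exact Or.inr (Or.inl h')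
      · exact Or.inr (Or.inr h')
  -- separation of `Ball` from everything `Λ` touches
  have hsepNear : ∀ {q : Site 2}, (∃ x ∈ closedSq δ q, dist x qt < r' ∨ dist x qb < r') → ¬ ∃ y ∈ Ball, y ∈ closedSq δ q := by
    rintro q ⟨x, hxq, hxd⟩ ⟨y, hy, hyq⟩
    have hxy := dist_le_of_mem_closedSq hxq hyq
    obtain ⟨hyb, hyt⟩ := hd₂ y hy
    rcases hxd with hxd | hxd
    · linarith [dist_triangle y x qt, dist_comm y x]
    · linarith [dist_triangle y x qb, dist_comm y x]
  have hBout_notΛ : ∀ q ∈ Λ.support, ¬ ∃ y ∈ Bout, y ∈ closedSq δ q := by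
    intro q hq hy
    rcases hΛtouch q hq with ⟨x, hxA, hxq⟩ | h' | ⟨x, hx, hxq⟩
    · exact not_near_both hy ⟨x, hxA, hxq⟩ (fun a ha b hb => by linarith [hsep₂ a ha b hb])
    · obtain ⟨y, hyB, hyq⟩ := hy; exact hsepNear h' ⟨y, hBoutsub hyB, hyq⟩
    · obtain ⟨y, hyB, hyq⟩ := hy
      exact not_near_both ⟨x, hx, hxq⟩ ⟨y, hBoutsub hyB, hyq⟩ (fun a ha b hb => by linarith [hsep₅ a ha b hb])
  have hB3_notΛ₁ : ∀ q ∈ Λ₁.support, ¬ ∃ y ∈ B3, y ∈ closedSq δ q := by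
    intro q hq hy
    obtain ⟨y, hyB, hyq⟩ := hy
    rcases hΛ₁touch q hq with ⟨x, hx, hxq⟩ | h'
    · exact not_near_both ⟨x, hx, hxq⟩ ⟨y, hB3sub hyB, hyq⟩ (fun a ha b hb => by linarith [hsep₁ a ha b hb])
    · exact hsepNear h' ⟨y, hB3sub hyB, hyq⟩
  have hB3_notΛ₂ : ∀ q ∈ Λ₂.support, ¬ ∃ y ∈ B3, y ∈ closedSq δ q := by
    intro q hq hy
    obtain ⟨y, hyB, hyq⟩ := hy
    rcases hΛ₂touch q hq with ⟨x, hx, hxq⟩ | h' | ⟨x, hx, hxq⟩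
    · exact not_near_both ⟨x, hx, hxq⟩ ⟨y, hB3sub hyB, hyq⟩ (fun a ha b hb => by linarith [hsep₁ a ha b hb])
    · exact hsepNear h' ⟨y, hB3sub hyB, hyq⟩
    · exact not_near_both ⟨x, hx, hxq⟩ ⟨y, hB3sub hyB, hyq⟩ (fun a ha b hb => by linarith [hsep₅ a ha b hb])
  -- ### the crossing with `Γ_H`
  have hcross := walkWinding_sub_eq_one_of_crossData hδ hHc hr hsᵢ hsᵢₒ hsₒ Λ₁ Λ₂ hBout_notΛ hB3_notΛ₁ hB3_notΛ₂ hcol hcol' hrow hrow'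
  rw [hH0eq, hH1eq] at hcross
  change walkWinding Λ _ - walkWinding Λ _ = 1 at hcross
  rw [← hΛeq] at hcross
  -- ### no square of the loop is at the Dirichlet arcs
  have harcface : ∀ i : Fin 4, (i = 0 ∨ i = 2) → ∀ f : Site 2,
      (∃ w ∈ closedSq δ f, Metric.infDist w (R.arc i) ≤ 2 * δ) → f ∉ ((Walk.cons hpbnb.symm v).append (Walk.cons hptnt β)).support := by
    rw [hΛeq]
    intro i hi f hf hfΛ
    obtain ⟨w, hwf, hwd⟩ := hf
    have harcne : (R.arc i).Nonempty := ⟨_, R.pt_mem_arc_self i⟩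
    obtain ⟨a, ha, hwa⟩ := (R.isCompact_arc i).exists_infDist_eq_dist harcne w
    have hwa' : dist w a ≤ 2 * δ := by rw [← hwa]; exact hwd
    have ha02 : a ∈ R.arc 0 ∪ R.arc 2 := hi.elim (fun h => Or.inl (h ▸ ha)) (fun h => Or.inr (h ▸ ha))
    rcases hΛtouch f hfΛ with ⟨x, hx, hxf⟩ | ⟨x, hxf, hxd⟩ | ⟨x, hx, hxf⟩
    · have h1 := hsep₃ a ha02 x hx
      have h2 := dist_le_of_mem_closedSq hwf hxf
      linarith [dist_triangle a w x, dist_comm a w]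
    · have h2 := dist_le_of_mem_closedSq hwf hxf
      obtain ⟨h1b, h1t⟩ := hd₁ a ha02
      rcases hxd with hxd | hxd
      · linarith [dist_triangle a w x, dist_comm a w, dist_triangle a x qt]
      · linarith [dist_triangle a w x, dist_comm a w, dist_triangle a x qb]
    · have h1 := hsep₆ x hx a ha02
      have h2 := dist_le_of_mem_closedSq hwf hxf
      linarith [dist_triangle x w a, dist_comm w x]
  -- ### the flux identity
  have hvinner : ∀ z ∈ v.support, IsInnerFace R.carrier δ z := by
    intro z hz
    rw [hv, Walk.mem_support_append_iff, Walk.mem_support_append_iff, Walk.support_reverse, List.mem_reverse] at hz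
    rcases hz with hz | hz | hz
    · exact hreach_inner (hw₁F z hz)
    · exact hcol_inner z hz
    · exact hreach_inner (hu₁F z hz)
  have hident := faceExitVal_sub_eq_of_crossData R hδ hfin hTBn hharm hp₀inner hpbnb hptnt v hvinner hpbF β hβ0 hLR hσH0 hσH1
    harcface hcross
  -- ### conclusion
  refine ⟨hp₀inner, pb, nb, pt, nt, hpbnb, hptnt, hpbF, hptF, hnbF, hntF, ?_, ?_, hident⟩
  · obtain ⟨w, hw, hwd⟩ := hnb_near; exact ⟨w, hw, by linarith⟩
  · obtain ⟨w, hw, hwd⟩ := hnt_near; exact ⟨w, hw, by linarith⟩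

end KirchhoffSlope

end Summit.CriticalPhenomena.CardyFormulaZ2.Theorems
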